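import Mathlib
import Summits.KontsevichZagierPeriods.Zeta5Search.FourthOrderBracket
import Summits.KontsevichZagierPeriods.Zeta5Search.FourthOrderShape
import HarnessLib

/-!
# ζ(5) search — the TRANSLATION LEMMA for the `v̂`-functional of a T-shape (tools for THEOREM L5, `SecondResidueLaw.LawA5`)

Cell `pub-zeta5` (HONEST FRAMING: systematic search; no irrationality claim unless certified), typer seat generation 13.
REPORT-gen2-g14 §2, Lemma Tr: for a class whose levels `0, …, a−1` are ZEROS (the prefix of a T-shape), the `v̂`-functional of
`G·Φ_x` computed with the harmonic numbers `H_ℓ^{(σ)}` at the own levels equals the one computed with `H_{ℓ−a}^{(σ)}`: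
the difference `Σ_{t<a} Σ_{q,σ} ρ[GΦ_x]_{q,σ} (t − ℓ_q)^{−σ} = Σ_{t<a} (G·Φ_x)(t)` vanishes because the prefix levels are zeros of `Φ_x`
(partial fractions of the class function, `classPF` of typer g9, at the points `t`).  In the language of `FourthOrderFrame` /
`FourthOrderShape`: **`frameVPoly L e (G·Z) = frameVPolySh a L e (G·Z)`** for the own type `(L, e)` of the class (`Z` the centre
factor), whenever `deg G < −E_x` (`frameVPoly_translate`).  This is the general form of `typeCorr_eq_zero_of_consClass` (typer g11,
prefix length `1`).  Bookkeeping of rational numbers; nothing here bears on irrationality.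
-/

noncomputable section

open Finset PowerSeries

namespace Summit.KontsevichZagierPeriods.Zeta5Search.SecondOrder

open Summit.KontsevichZagierPeriods.Zeta5Search.ClusterValuation
open Summit.KontsevichZagierPeriods.Zeta5Search.PadicSeries
open Summit.KontsevichZagierPeriods.Zeta5Search.CasoratianValuation (InPolytope)
open Summit.KontsevichZagierPeriods.Zeta5Search.LevelClass (typeRho typeW typeV classSet_level level_injective level_mem
  classPoles_level)
open Summit.KontsevichZagierPeriods.Zeta5Search.CellA (harm_succ)
open Literature.NumberTheory.Transcendental.BallRivoal (harm)

variable {p : ℕ} [hp : Fact p.Prime]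

/-! ## §1 Harmonic numbers shifted by `a` levels -/

omit hp in
/-- **`H_k^{(σ)} = H_{k−a}^{(σ)} + Σ_{t<a} (k − t)^{−σ}`** for `a ≤ k`. -/
theorem harm_eq_harm_sub_add (σ : ℕ) {a k : ℕ} (hak : a ≤ k) :
    harm σ k = harm σ (k - a) + ∑ t ∈ range a, 1 / (((k - t : ℕ) : ℚ)) ^ σ := by
  induction a with
  | zero => simp
  | succ a ih =>
    have h1 : harm σ (k - a) = harm σ (k - (a + 1)) + 1 / (((k - a : ℕ) : ℚ)) ^ σ := by
      have : k - a = (k - (a + 1)) + 1 := by omega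
      rw [this, harm_succ, Nat.cast_add, Nat.cast_one]
    rw [ih (by omega), sum_range_succ, h1]; ring

/-! ## §2 Linearity of the shifted functional -/

omit hp in
/-- `v̂^{(a)}` is additive. -/
theorem frameVPolySh_add (a L : ℕ) (f : ℕ → ℤ) (G H : Polynomial ℚ) :
    frameVPolySh a L f (G + H) = frameVPolySh a L f G + frameVPolySh a L f H := by
  unfold frameVPolySh; rw [← sum_add_distrib]
  refine sum_congr rfl fun i _ => ?_
  rw [← sum_add_distrib]
  exact sum_congr rfl fun σ _ => by rw [frameRho_add]; ring

omit hp in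
/-- `v̂^{(a)}` commutes with scalars. -/
theorem frameVPolySh_C_mul (a L : ℕ) (f : ℕ → ℤ) (c : ℚ) (G : Polynomial ℚ) :
    frameVPolySh a L f (Polynomial.C c * G) = c * frameVPolySh a L f G := by
  unfold frameVPolySh; rw [mul_sum]
  refine sum_congr rfl fun i _ => ?_
  rw [mul_sum]
  exact sum_congr rfl fun σ _ => by rw [frameRho_C_mul]; ring

omit hp in
/-- `v̂^{(a)}` of a finite sum. -/
theorem frameVPolySh_sum {ι : Type*} (a L : ℕ) (f : ℕ → ℤ) (s : Finset ι) (G : ι → Polynomial ℚ) :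
    frameVPolySh a L f (∑ k ∈ s, G k) = ∑ k ∈ s, frameVPolySh a L f (G k) := by
  classical
  induction s using Finset.induction_on with
  | empty =>
    rw [sum_empty, sum_empty]
    unfold frameVPolySh
    exact sum_eq_zero fun i _ => sum_eq_zero fun σ _ => by rw [frameRho_zero]; ring
  | insert x s hx ih => rw [sum_insert hx, sum_insert hx, frameVPolySh_add, ih]

/-! ## §3 The vanishing of the translation term (partial fractions at the prefix zeros) -/

section Translate

variable (b : ℕ → ℤ) (hb : InPolytope b) {x L : ℕ} (hx : x < p) (hL : x + L * p ≤ (b 0).toNat)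
  (hL' : (b 0).toNat < x + L * p + p) (e : ℕ → ℤ) (he : ∀ k ≤ L, netExp b (x + k * p) = e k)
  {a : ℕ} (hzero : ∀ k < a, k ≤ L → 1 ≤ e k)
include hb hx hL hL' he hzero

omit hb in
/-- **The translation term of a monomial vanishes at a prefix zero**: for `t < a` (a zero level of the class) and `n < −E_x`,
`Σ_{poles k} Σ_σ (−1)^σ ρ^{(n)}_{x+kp,σ} (k − t)^{−σ} = 0`. -/
theorem transl_term_eq_zero (n : ℕ) (hdeg : degN b p x + n < degD b p x) {t : ℕ} (ht : t < a) :
    ∑ k ∈ (range (L + 1)).filter (fun k => e k < 0), ∑ σ ∈ Icc 1 (-e k).toNat,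
      (-1 : ℚ) ^ σ * rhoK b p (x + k * p) n σ * (1 / (((k - t : ℕ) : ℚ)) ^ σ) = 0 := by
  have hp0 : 0 < p := hp.out.pos
  -- poles sit at levels `≥ a > t`
  have hpole : ∀ k ∈ (range (L + 1)).filter (fun k => e k < 0), t < k := by
    intro k hk
    obtain ⟨hkr, hneg⟩ := mem_filter.1 hk
    by_contra h
    have := hzero k (by omega) (by have := mem_range.1 hkr; omega)
    omega
  by_cases hem : (range (L + 1)).filter (fun k => e k < 0) = ∅
  · rw [hem, sum_empty]
  obtain ⟨k₀, hk₀⟩ := nonempty_iff_ne_empty.2 hem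
  have htL : t ≤ L := by have := hpole k₀ hk₀; have := mem_range.1 (mem_filter.1 hk₀).1; omega
  -- the partial-fraction identity, evaluated at `t`
  have hPF := congrArg (Polynomial.eval (t : ℚ)) (classPF b hp0 n hdeg)
  -- the numerator vanishes at `t`
  have htmem : x + t * p ∈ classSet b p x := level_mem b hx hL hL' htL
  have het : 1 ≤ netExp b (x + t * p) := by rw [he t htL]; exact hzero t ht htL
  have hlv : ∀ k, lvl p (x + k * p) = (k : ℚ) := fun k => by unfold lvl; rw [level_div hx]
  have hN0 : (numPhi b p x).eval (t : ℚ) = 0 := by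
    unfold numPhi
    rw [Polynomial.eval_mul, Polynomial.eval_prod]
    refine mul_eq_zero_of_left (prod_eq_zero (mem_filter.2 ⟨htmem, by omega⟩) ?_) _
    rw [hlv, Polynomial.eval_pow, Polynomial.eval_sub, Polynomial.eval_X, Polynomial.eval_C, sub_self,
      zero_pow (by omega)]
  rw [Polynomial.eval_mul, hN0, mul_zero] at hPF
  simp only [Polynomial.eval_finsetSum, Polynomial.eval_mul, Polynomial.eval_C] at hPF
  -- the poles of the class by levels
  have hP : classPoles b p x = ((range (L + 1)).filter fun k => e k < 0).image fun k => x + k * p :=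
    classPoles_level b hx hL hL' e he
  -- the denominator at `t`
  set D0 := (denPhi b p x).eval (t : ℚ) with hD0
  have hD0ne : D0 ≠ 0 := by
    rw [hD0, denPhi, Polynomial.eval_prod]
    refine prod_ne_zero_iff.2 fun q hq => ?_
    rw [hP] at hq
    obtain ⟨k, hk, rfl⟩ := mem_image.1 hq
    have htk := hpole k hk
    rw [Polynomial.eval_pow, Polynomial.eval_sub, Polynomial.eval_X, Polynomial.eval_C, hlv]
    exact pow_ne_zero _ (sub_ne_zero.2 (by exact_mod_cast (show t ≠ k by omega)))
  have hpfM : ∀ q ∈ classPoles b p x, ∀ σ ∈ Icc 1 (-netExp b q).toNat,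
      (pfM b p x q σ).eval (t : ℚ) = D0 * (((t : ℚ) - lvl p q) ^ σ)⁻¹ := by
    intro q hq σ hσ
    have hσ' := (mem_Icc.1 hσ).2
    have hq' := hq
    rw [hP] at hq'
    obtain ⟨k, hk, rfl⟩ := mem_image.1 hq'
    have htk := hpole k hk
    have hz : ((t : ℚ) - lvl p (x + k * p)) ≠ 0 := by
      rw [hlv]; exact sub_ne_zero.2 (by exact_mod_cast (show t ≠ k by omega))
    have hD : D0 = (denOff b p x (x + k * p)).eval (t : ℚ) * ((t : ℚ) - lvl p (x + k * p)) ^ (-netExp b (x + k * p)).toNat := by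
      rw [hD0, denPhi_eq_denOff_mul b p x hq, Polynomial.eval_mul, Polynomial.eval_pow, Polynomial.eval_sub, Polynomial.eval_X,
        Polynomial.eval_C]
    rw [pfM, Polynomial.eval_mul, Polynomial.eval_pow, Polynomial.eval_sub, Polynomial.eval_X, Polynomial.eval_C, hD, mul_assoc,
      ← pow_sub₀ _ hz hσ']
  have hsum : ∑ q ∈ classPoles b p x, ∑ σ ∈ Icc 1 (-netExp b q).toNat, rhoK b p q n σ * (pfM b p x q σ).eval (t : ℚ) =
      D0 * ∑ q ∈ classPoles b p x, ∑ σ ∈ Icc 1 (-netExp b q).toNat, rhoK b p q n σ * (((t : ℚ) - lvl p q) ^ σ)⁻¹ := by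
    rw [mul_sum]
    refine sum_congr rfl fun q hq => ?_
    rw [mul_sum]
    refine sum_congr rfl fun σ hσ => ?_
    rw [hpfM q hq σ hσ]; ring
  rw [hsum] at hPF
  have hS : ∑ q ∈ classPoles b p x, ∑ σ ∈ Icc 1 (-netExp b q).toNat, rhoK b p q n σ * (((t : ℚ) - lvl p q) ^ σ)⁻¹ = 0 := by
    rcases mul_eq_zero.1 hPF.symm with h | h
    · exact absurd h hD0ne
    · exact h
  rw [hP, sum_image (fun u _ v _ h => level_injective hp0 x h)] at hS
  rw [← hS]
  refine sum_congr rfl fun k hk => ?_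
  have hkL : k ≤ L := by have := mem_range.1 (mem_filter.1 hk).1; omega
  have htk := hpole k hk
  rw [he k hkL]
  refine sum_congr rfl fun σ _ => ?_
  rw [hlv, show ((t : ℚ) - k) = (-1) * (((k - t : ℕ) : ℚ)) by push_cast [htk.le]; ring, mul_pow, mul_inv, ← inv_pow,
    inv_neg_one]
  ring

/-- **TRANSLATION LEMMA**: for a polynomial `G` with `deg G + Z < P` (degrees of numerator/denominator of `Φ_x`; i.e. `deg G < −E_x`),
the `v̂`-functional of `G·Z·Φ_T` on the own type with harmonic numbers at the own levels equals the one with the levels shifted down by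
the prefix length `a`. -/
theorem frameVPoly_translate (G : Polynomial ℚ) (hdeg : G.natDegree + degN b p x < degD b p x) :
    frameVPoly L e (G * centreZ b p x L) = frameVPolySh a L e (G * centreZ b p x L) := by
  -- expand `G` in monomials
  have hG : G * centreZ b p x L = ∑ n ∈ G.support, Polynomial.C (G.coeff n) * (Polynomial.X ^ n * centreZ b p x L) := by
    conv_lhs => rw [G.as_sum_support_C_mul_X_pow]
    rw [sum_mul]
    exact sum_congr rfl fun n _ => by ring
  rw [hG, frameVPoly_sum, frameVPolySh_sum]
  refine sum_congr rfl fun n hn => ?_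
  have hnd : degN b p x + n < degD b p x := by
    have := Polynomial.le_natDegree_of_mem_supp n hn; omega
  rw [frameVPoly_C_mul, frameVPolySh_C_mul]
  congr 1
  -- the monomial case
  unfold frameVPoly frameVPolySh
  rw [← sub_eq_zero, ← sum_sub_distrib]
  have hpole : ∀ k ∈ (range (L + 1)).filter (fun k => e k < 0), a ≤ k := by
    intro k hk
    obtain ⟨hkr, hneg⟩ := mem_filter.1 hk
    by_contra h
    have := hzero k (by omega) (by have := mem_range.1 hkr; omega)
    omega
  have hrw : ∀ k ∈ (range (L + 1)).filter (fun k => e k < 0),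
      (∑ σ ∈ Icc 1 (-e k).toNat, (-1 : ℚ) ^ σ * frameRho L e (Polynomial.X ^ n * centreZ b p x L) k σ * harm σ k) -
        (∑ σ ∈ Icc 1 (-e k).toNat, (-1 : ℚ) ^ σ * frameRho L e (Polynomial.X ^ n * centreZ b p x L) k σ * harm σ (k - a)) =
      ∑ t ∈ range a, ∑ σ ∈ Icc 1 (-e k).toNat,
        (-1 : ℚ) ^ σ * rhoK b p (x + k * p) n σ * (1 / (((k - t : ℕ) : ℚ)) ^ σ) := by
    intro k hk
    have hkL : k ≤ L := by have := mem_range.1 (mem_filter.1 hk).1; omega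
    rw [← sum_sub_distrib, sum_comm]
    refine sum_congr rfl fun σ hσ => ?_
    have hσ' := mem_Icc.1 hσ
    rw [harm_eq_harm_sub_add σ (hpole k hk), ← rhoK_levelZ b hb hx hL hL' e he hkL n (by omega), mul_add,
      add_sub_cancel_left, mul_sum]
  rw [sum_congr rfl hrw, sum_comm]
  exact sum_eq_zero fun t ht => transl_term_eq_zero b hx hL hL' e he hzero n hnd (mem_range.1 ht)

end Translate

end Summit.KontsevichZagierPeriods.Zeta5Search.SecondOrder

end
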